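import Summits.QuantumFields.YangMills.Theorems.FluctuationComparisonRegPrIntLS2BetaBodyDoorSmoothMoved
import Summits.QuantumFields.YangMills.Theorems.FluctuationComparisonRegPrIntLS2BetaSmoothMovedSizes
import HarnessLib

/-!
# S2β · GAP♯∘ — (α-KNIT) «THE (RES-u) KNIT BY ONE NAME»: for an admissible GAP♯∘ triple `(V, U₀, U)` and the (RES-u) letters, there are a RESIDUAL `r`, Thm 2's gauge `u` for the
# pair `(r•U₀, U)`, its twist `E`, and a LIPSCHITZ lift `û` of `(u↓)⁻¹` such that the GAP♯∘ BODY at `(V, U₀, U)` ⟺ the BODY at the smooth-moved triple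
# `((u↓)⁻¹•V, û•(r•U₀), u⁻¹•U)`, the moved triple is admissible, `u⁻¹•U = E·(r•U₀)`, and EVERY size the rows read there is fine-small

Cell `ym3-torus` (rung R3 = continuum `SU(2)` YM₃ on T³ at fixed lattice data — NOT d = 4, NOT infinite volume, NOT a mass gap, NOT Clay).  Width seat
`ym-ust-20520-w5` (gen 29), explicit-unit helper on crux `stmt-QuantumFields-20520`, LINE g18-1 S2β (registry untouched), organ GAP♯∘, node (RES-u) (architect px17 g23
2026-09-01T01:09Z «TRIPLE MOVE + COMMUTATOR LETTER»; desk RULINGS №129∕№131; «E_J-FACE» px21 g26 → exit (a) smooth lift + smooth residual copy).  COMPOSITION BY NAME of the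
organ's landed files: doors ✓p840512 `…BodyDoorSmoothMoved` (px16 g24: `body_iff_body_smoothMoved`, `smoothMoved_mem_argmin`) + ✓p839899 `thm2Moved_mem_fibre`; sizes
✓p840523 `…SmoothMovedSizes.exists_smoothMoved_sizes` (w5: `r` from ✓p840422, `û` from ✓p840262 px21, sizes from ✓p839678∕✓p840003); the lift's gradient input `τ′ := 4σ_V + e`
from the DEFECT equation `(u↓)⁻¹•V = D` (✓p840003 `bondGrad_descTransf_le_SU_of_defect`, `bondGrad_inv_le`).
DISPLAYED LETTERS (all HYPOTHESES): the (7σ)⁺ letters {`hgArc` = `hBG` read at level `K`, the (BKG) binder `hBKG`+`hδ`+`h6`, the √θ-gauge `hσV`, the window `τ_β ≤ 1∕8`};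
`hThm2` = Thm 2 of [Balaban1985RegularSpaces] run on the pair `(W, U)` for EVERY `W` in the argmin set, in the torus reading of the (R-3) lineage: `∃ u E D, u⁻¹•U = E·W ∧
(u↓)⁻¹•V = D ∧ ∀ B, dist1 (D B·(V B)⁻¹) ≤ e` — its last clause is [Balaban1985RegularSpaces] (1.37) `C137T` read through the block-averaging dictionary (OPEN, the one input of the
organ not on the tree); the window `4σ_V + e ≤ 1∕8`.
* ★★★`residualKnit` — the statement above, BODY = ✓p838507's conclusion tail VERBATIM on both sides (as in ✓p840512), argmin set = GAP♯∘'s text.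
`--kind proof --supports stmt-QuantumFields-20520 --as helper`, DEFINITION-FREE (0 `def`, 0 `instance`, 0 `sorry`; default heartbeats).

HONEST.  Composition by name, zero mathematics of its own; every input is a HYPOTHESIS (`hBG`@K and (BKG) are conjecture-class letters of the lane; `hThm2` rests on
✓`B8Thm2AtT3Members`, UNPROVED at `L = 3`, and on the OPEN averaging dictionary for `e`); nothing of Bałaban's analysis is asserted or proved ([Balaban1985Averaging] (8) p.18,
(11)–(13) p.19; [Balaban1985Variational] (4) p.278, Thm 1 (8)–(10) p.279; [Balaban1985RegularSpaces] (1.29) p.81, (1.36)–(1.38) p.82, Thm 2 p.83); GAP♯∘ (`stub_uniformFibreGapOrbit`,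
0∕5), the five REGISTERED stubs, S2β, crux 20520, 19936, 19200, `YM3TorusSU2` NOT proved; no summit statement is proved by a helper; rung R3 = SU(2) YM₃ on T³ — NOT d = 4, NOT
infinite volume, NOT a mass gap, NOT Clay; the Yang–Mills mass gap is NOT proved.
-/

set_option autoImplicit false

noncomputable section

namespace Summit.QuantumFields.YangMills.Theorems.FluctuationComparisonRegPrIntLS2BetaResidualKnit

open Literature.MathematicalPhysics.QuantumLattice (su2Quat)
open Literature.MathematicalPhysics.QuantumFieldTheory.Balaban1983to89
open T4Continuum T3ContinuumYM3Torus T3UnitScaleTilt T3TiltDescent T3LevelShift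
open T3UnitLawDensityEML (ℰp)
open T3ConstrainedMinimiser (fibre)
open T3PrintedRegularMinimiser (minActionRegPr)
open T3PrintedRegularOrbits (descTransf)
open T4ExpWindowSmallField (logVec)
open ExpMeanLog (deltaSU)
open Summit.QuantumFields.YangMills.Theorems.FluctuationComparisonRegPrIntLS2BetaBodyDoorSmoothMoved (body_iff_body_smoothMoved smoothMoved_mem_argmin)
open Summit.QuantumFields.YangMills.Theorems.FluctuationComparisonRegPrIntLS2BetaBodyDoorThm2Moved (thm2Moved_mem_fibre)
open Summit.QuantumFields.YangMills.Theorems.FluctuationComparisonRegPrIntLS2BetaSmoothMovedSizes (exists_smoothMoved_sizes)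
open Summit.QuantumFields.YangMills.Theorems.FluctuationComparisonRegPrIntLS2BetaLiftGradientFeed (bondGrad_descTransf_le_SU_of_defect bondGrad_inv_le)

variable (F : T3Family) {J K : ℕ} (hJK : J ≤ K)

/-- ★★★ **THE (RES-u) KNIT BY ONE NAME.**  For `ε₀ ≥ 0`, `U₀` in the argmin set over `V`, `U` over `V`, the (7σ)⁺ letters, Thm 2's representative for every argmin background
(`hThm2`, with the coarse defect size `e`), and the window `4σ_V + e ≤ 1∕8`: there are `r u E û` with `r` RESIDUAL, `û↓ = (u↓)⁻¹`, the GAP♯∘ BODY at `(V, U₀, U)` ⟺ the BODY at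
`((u↓)⁻¹•V, û•(r•U₀), u⁻¹•U)` (every `μ`), the moved minimiser in the argmin set over the moved datum, the moved field in its fibre, `u⁻¹•U = E·(r•U₀)`, and the sizes
`dist1 ((r•U₀) b·((û•(r•U₀)) b)⁻¹) ≤ 4σ̃ + γ`, `dist1 ((û•(r•U₀)) b) ≤ σ̃ + γ`, `dist1 (û x·(û (walkEnd x w))⁻¹) ≤ |w|·γ`, `σ̃ := s + 2π·τ_β·(L⁻¹)^{K−J}`,
`γ := 2π·(4σ_V + e)·(L⁻¹)^{K−J}`. [cite: Balaban1985Variational, Thm 1 (8)-(10) p.279, (4) p.278; Balaban1985RegularSpaces, Thm 2 p.83, (1.36)-(1.38) p.82; Balaban1985Averaging, (8) p.18, (11)-(13) p.19] -/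
theorem residualKnit {ε₀ γ' b₀ p₀ : ℝ} (hε₀ : 0 ≤ ε₀) {g : Site (F.P K) 0 → Matrix.specialUnitaryGroup (Fin 2) ℂ}
    {V : GaugeField (F.P J) 0 (Matrix.specialUnitaryGroup (Fin 2) ℂ)} {U₀ U : GaugeField (F.P K) 0 (Matrix.specialUnitaryGroup (Fin 2) ℂ)}
    {s C_B α σV e : ℝ}
    (hU₀ : U₀ ∈ {U' : GaugeField (F.P K) 0 (Matrix.specialUnitaryGroup (Fin 2) ℂ) | U' ∈ fibre F ℰp J K hJK V ∧
      U' ∈ histGood F ℰp (θBal F.L γ' b₀ p₀) K J ∧ wilsonAction4 U' = minActionRegPr F J K hJK ε₀ V})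
    (hU : U ∈ fibre F ℰp J K hJK V)
    (hgArc : ∀ e : PBond (F.P K) 0, ‖logVec (su2Quat (GaugeField.gaugeAct g U₀ e))‖ ≤ s) (hCB : 0 ≤ C_B) (hα : 0 ≤ α)
    (hBKG : ∀ t, t ≤ K - J → ∀ p : Plaq (F.P K) t,
      dist1 (GaugeField.plaqHol (Averaging.iter (fun k => BlockAveraging.blockAvg (P := F.P K) (j := k) ℰp) t U₀) p) ≤
        C_B * α * (F.L : ℝ) ^ (2 * t) * ((F.L : ℝ)⁻¹) ^ (2 * (K - J)))
    (hδ : ((((3 + 2) * F.L : ℕ) : ℝ) ^ 2 / 4) * (C_B * α) < deltaSU (Fin 2))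
    (h6 : ((((3 + 2) * F.L : ℕ) : ℝ) ^ 2 / 4) * (C_B * α) ≤ 1 / 6)
    (hσV : ∀ B : PBond (F.P J) 0, dist1 (V B) ≤ σV)
    (hτ0 : 0 ≤ ((F.L : ℝ) ^ (K - J) * s + ((3 + 2) ^ 2 * (F.L : ℝ) / (2 * ((F.L : ℝ) - 1))) * (C_B * α)) + σV)
    (hτ : ((F.L : ℝ) ^ (K - J) * s + ((3 + 2) ^ 2 * (F.L : ℝ) / (2 * ((F.L : ℝ) - 1))) * (C_B * α)) + σV ≤ 1 / 8)
    (hThm2 : ∀ W : GaugeField (F.P K) 0 (Matrix.specialUnitaryGroup (Fin 2) ℂ),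
      W ∈ {U' : GaugeField (F.P K) 0 (Matrix.specialUnitaryGroup (Fin 2) ℂ) | U' ∈ fibre F ℰp J K hJK V ∧
        U' ∈ histGood F ℰp (θBal F.L γ' b₀ p₀) K J ∧ wilsonAction4 U' = minActionRegPr F J K hJK ε₀ V} →
      ∃ (u : Site (F.P K) 0 → Matrix.specialUnitaryGroup (Fin 2) ℂ) (E : PBond (F.P K) 0 → Matrix.specialUnitaryGroup (Fin 2) ℂ)
        (D : GaugeField (F.P J) 0 (Matrix.specialUnitaryGroup (Fin 2) ℂ)),
        GaugeField.gaugeAct (fun x => (u x)⁻¹) U = (fun b => E b * W b) ∧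
        GaugeField.gaugeAct (fun x => (descTransf F J K hJK u x)⁻¹) V = D ∧
        ∀ B : PBond (F.P J) 0, dist1 (D B * (V B)⁻¹) ≤ e)
    (hσV0 : 0 ≤ σV) (he0 : 0 ≤ e) (hτ'8 : 4 * σV + e ≤ 1 / 8) :
    ∃ (r u : Site (F.P K) 0 → Matrix.specialUnitaryGroup (Fin 2) ℂ) (E : PBond (F.P K) 0 → Matrix.specialUnitaryGroup (Fin 2) ℂ)
      (û : Site (F.P K) 0 → Matrix.specialUnitaryGroup (Fin 2) ℂ),
      (∀ U' : GaugeField (F.P K) 0 (Matrix.specialUnitaryGroup (Fin 2) ℂ),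
          descendTo F ℰp J K hJK (GaugeField.gaugeAct r U') = descendTo F ℰp J K hJK U') ∧
      descTransf F J K hJK û = (fun x => (descTransf F J K hJK u x)⁻¹) ∧
      (∀ μ : ℝ,
        (μ * ((F.L : ℝ)⁻¹) ^ (2 * (K - J)) *
              (⨅ w : {w : GaugeTransf (F.P K) 0 (Matrix.specialUnitaryGroup (Fin 2) ℂ) | ∀ U : GaugeField (F.P K) 0 (Matrix.specialUnitaryGroup (Fin 2) ℂ),
                  descendTo F ℰp J K hJK (GaugeField.gaugeAct w U) = descendTo F ℰp J K hJK U}, ∑ ℓ : PBond (F.P K) 0,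
                dist1 ((U) ℓ *
                  ((GaugeField.gaugeAct (w : GaugeTransf (F.P K) 0 (Matrix.specialUnitaryGroup (Fin 2) ℂ)) (U₀)) ℓ)⁻¹) ^ 2)
            ≤ wilsonAction4 (U) - minActionRegPr F J K hJK ε₀ (V)) ↔
        (μ * ((F.L : ℝ)⁻¹) ^ (2 * (K - J)) *
              (⨅ w : {w : GaugeTransf (F.P K) 0 (Matrix.specialUnitaryGroup (Fin 2) ℂ) | ∀ U : GaugeField (F.P K) 0 (Matrix.specialUnitaryGroup (Fin 2) ℂ),
                  descendTo F ℰp J K hJK (GaugeField.gaugeAct w U) = descendTo F ℰp J K hJK U}, ∑ ℓ : PBond (F.P K) 0,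
                dist1 ((GaugeField.gaugeAct (fun x => (u x)⁻¹) U) ℓ *
                  ((GaugeField.gaugeAct (w : GaugeTransf (F.P K) 0 (Matrix.specialUnitaryGroup (Fin 2) ℂ)) (GaugeField.gaugeAct û (GaugeField.gaugeAct r U₀))) ℓ)⁻¹) ^ 2)
            ≤ wilsonAction4 (GaugeField.gaugeAct (fun x => (u x)⁻¹) U) -
              minActionRegPr F J K hJK ε₀ (GaugeField.gaugeAct (fun x => (descTransf F J K hJK u x)⁻¹) V))) ∧
      GaugeField.gaugeAct û (GaugeField.gaugeAct r U₀) ∈ {U' : GaugeField (F.P K) 0 (Matrix.specialUnitaryGroup (Fin 2) ℂ) |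
        U' ∈ fibre F ℰp J K hJK (GaugeField.gaugeAct (fun x => (descTransf F J K hJK u x)⁻¹) V) ∧ U' ∈ histGood F ℰp (θBal F.L γ' b₀ p₀) K J ∧
        wilsonAction4 U' = minActionRegPr F J K hJK ε₀ (GaugeField.gaugeAct (fun x => (descTransf F J K hJK u x)⁻¹) V)} ∧
      GaugeField.gaugeAct (fun x => (u x)⁻¹) U ∈ fibre F ℰp J K hJK (GaugeField.gaugeAct (fun x => (descTransf F J K hJK u x)⁻¹) V) ∧
      GaugeField.gaugeAct (fun x => (u x)⁻¹) U = (fun b => E b * GaugeField.gaugeAct r U₀ b) ∧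
      (∀ b : PBond (F.P K) 0, dist1 (GaugeField.gaugeAct r U₀ b * (GaugeField.gaugeAct û (GaugeField.gaugeAct r U₀) b)⁻¹) ≤
        4 * (s + 2 * Real.pi * (((F.L : ℝ) ^ (K - J) * s + ((3 + 2) ^ 2 * (F.L : ℝ) / (2 * ((F.L : ℝ) - 1))) * (C_B * α)) + σV) *
          ((F.L : ℝ)⁻¹) ^ (K - J)) + 2 * Real.pi * (4 * σV + e) * ((F.L : ℝ)⁻¹) ^ (K - J)) ∧
      (∀ b : PBond (F.P K) 0, dist1 (GaugeField.gaugeAct û (GaugeField.gaugeAct r U₀) b) ≤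
        (s + 2 * Real.pi * (((F.L : ℝ) ^ (K - J) * s + ((3 + 2) ^ 2 * (F.L : ℝ) / (2 * ((F.L : ℝ) - 1))) * (C_B * α)) + σV) *
          ((F.L : ℝ)⁻¹) ^ (K - J)) + 2 * Real.pi * (4 * σV + e) * ((F.L : ℝ)⁻¹) ^ (K - J)) ∧
      (∀ (x : Site (F.P K) 0) (w : List (Letter (F.P K).d)),
        dist1 (û x * (û (walkEnd x w))⁻¹) ≤ (w.length : ℝ) * (2 * Real.pi * (4 * σV + e) * ((F.L : ℝ)⁻¹) ^ (K - J))) := by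
  -- `r` first (the smooth residual copy of the minimiser), with the `û`-supplier `H` for every admissible coarse `t`
  obtain ⟨r, hr, hmem, -, H⟩ := exists_smoothMoved_sizes F hJK hU₀ hgArc hCB hα hBKG hδ h6 hσV hτ0 hτ
  -- Thm 2 on the pair `(r•U₀, U)`: the gauge `u`, the twist `E`, the coarse defect `D`
  obtain ⟨u, E, D, hrep, hD, he⟩ := hThm2 (GaugeField.gaugeAct r U₀) hmem
  -- the coarse gradient of `(u↓)⁻¹` from the defect, then the Lipschitz lift `û`
  have hgrad := bondGrad_inv_le F hJK (bondGrad_descTransf_le_SU_of_defect F hJK hD hσV he)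
  obtain ⟨û, hû, hE', hbkg, hwalk⟩ := H (fun x => (descTransf F J K hJK u x)⁻¹) (4 * σV + e) (by positivity) hτ'8 hgrad
  exact ⟨r, u, E, û, hr, hû, fun μ => (body_iff_body_smoothMoved F hJK hε₀ u û hû hr μ V U₀ U).symm,
    smoothMoved_mem_argmin F hJK hε₀ u û hû hr V hU₀, thm2Moved_mem_fibre F hJK u hU, hrep, hE', hbkg, hwalk⟩

end Summit.QuantumFields.YangMills.Theorems.FluctuationComparisonRegPrIntLS2BetaResidualKnit

end
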